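import Literature.Analysis.FluidPDE.LerayHopf
import Literature.Analysis.FluidPDE.LerayHopfUniformEnergyMomentum
import Literature.Analysis.FluidPDE.LerayHopfSpectralMeasurability
import Literature.Analysis.FluidPDE.NSHopfEnergy
import Literature.Analysis.FunctionSpaces.TorusSobolevL4
import HarnessLib

/-!
# Route LoudWindows — support toward `FluxLedger`: torus Leray–Hopf solutions are `L³_{t,x}`

The Duchon–Robert facts of the tree (`Torus.integral_kernelFlux_mul_eq`,
`IsDistributionalNSSolutionOn.symmTestField_identity`, `Torus.ae_memLp_three_of_lintegral`, the
inviscid-limit lemmas) all consume the hypothesis `∫₀ᵀ ∫ ‖u‖³ < ∞`. This file discharges it for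
Leray–Hopf weak solutions on `T^d`, `2 ≤ d ≤ 4`, from the class alone
(`L^∞(0,T;L²) ∩ L²(0,T;H¹)`), through the tree's Sobolev embedding `H¹(T^d) ⊂ L⁴(T^d)`
(`Torus.lintegral_enorm_pow_four_le_eSobolevNorm`) and Cauchy–Schwarz `∫‖v‖³ ≤ ‖v‖₂ ‖v‖₄²`:

* `fluxLedger_lintegral_enorm_cube_le` — `∫‖v‖³ ≤ (∫‖v‖²)^{1/2} (∫‖v‖⁴)^{1/2}`;
* `fluxLedger_lintegral_enorm_cube_le_energy` — for `v ∈ L²`: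
  `∫‖v‖³ ≤ √K (∫‖v‖²)^{1/2} (∫‖v‖² + ‖∇v‖₂²)` (energy–enstrophy form, spectral `eGradNormSq`);
* `fluxLedger_lerayHopf_ae_lintegral_enorm_cube_le` / `…_lintegral_enorm_cube_lt_top` /
  `…_ae_memLp_three` — along a Leray–Hopf solution on `[0,T)`: a.e. slice bound
  `∫‖u(t)‖³ ≤ M (∫‖u(t)‖² + ‖∇u(t)‖₂²)` with `M < ∞`, `u ∈ L³((0,T) × T^d)`, a.e. slice in `L³`;
* `fluxLedger_globalLerayHopf_ae_lintegral_enorm_cube_le` — for a GLOBAL Leray–Hopf solution at a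
  steady mean-zero `L²` force and `ν > 0` the constant `M` is uniform in `T`
  (`Torus.IsGlobalLerayHopf.exists_forall_integral_norm_sq_le_of_hasZeroMean`), the form in which
  running time means of `‖u‖₃³` are controlled by those of energy and enstrophy.

Decomposition cell `decomp-ad`, lens-3 lineage g61 (route LoudWindows, support item
stmt-AnomalousDissipation-29695 `FluxLedger`; also the `L³` input of the asides
`FluxActivityBound` / `FluxPlateau`).

[cite: DuchonRobert2000, Prop. 1] [cite: RobinsonRodrigoSadowski2016, Thm 1.19 and Def. 4.9]
[cite: FoiasManleyRosaTemam2001, Ch. II App. A (A.27)]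
-/

noncomputable section

open MeasureTheory Filter Topology Set UnitAddTorus
open scoped ENNReal NNReal

namespace Summit.AnomalousDissipation.AnomalousDissipation.Theorems

open Literature.Analysis.FluidPDE Literature.Analysis.FunctionSpaces

set_option linter.dupNamespace false

variable {d : Type*} [Fintype d] [DecidableEq d]

omit [DecidableEq d] in
/-- **Cauchy–Schwarz for the cube**: `∫‖v‖³ ≤ (∫‖v‖²)^{1/2} (∫‖v‖⁴)^{1/2}` (lower Lebesgue
integrals, any strongly measurable `v`). [folklore] -/
theorem fluxLedger_lintegral_enorm_cube_le {F : Type*} [NormedAddCommGroup F]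
    {v : UnitAddTorus d → F} (hv : AEStronglyMeasurable v volume) :
    ∫⁻ x, ‖v x‖ₑ ^ 3 ≤ (∫⁻ x, ‖v x‖ₑ ^ 2) ^ (1 / 2 : ℝ) * (∫⁻ x, ‖v x‖ₑ ^ 4) ^ (1 / 2 : ℝ) := by
  have h := ENNReal.lintegral_mul_le_Lp_mul_Lq volume Real.HolderConjugate.two_two hv.enorm
    (hv.enorm.pow_const 2)
  have h3 : (fun x => ‖v x‖ₑ ^ 3) = (fun x => ‖v x‖ₑ) * fun x => ‖v x‖ₑ ^ 2 := by
    funext x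
    simp only [Pi.mul_apply]
    ring
  have h2 : ∀ x, ‖v x‖ₑ ^ (2 : ℝ) = ‖v x‖ₑ ^ 2 := fun x => by
    rw [← ENNReal.rpow_natCast]
    norm_num
  have h4 : ∀ x, (‖v x‖ₑ ^ 2) ^ (2 : ℝ) = ‖v x‖ₑ ^ 4 := fun x => by
    rw [← ENNReal.rpow_natCast _ 2, ← ENNReal.rpow_natCast _ 4, ← ENNReal.rpow_mul]
    norm_num
  rw [h3]
  refine h.trans (le_of_eq ?_)
  simp only [h2, h4, one_div]

/-- **`H¹ ⊂ L⁴` in energy–enstrophy form, cubed**: on `T^d`, `2 ≤ d ≤ 4`, there is `K` with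
`∫‖v‖³ ≤ (∫‖v‖²)^{1/2} · (K^{1/2} (∫‖v‖² + ‖∇v‖₂²))` for every `v ∈ L²(T^d; ℝ^d)`
(`Torus.lintegral_enorm_pow_four_le_eSobolevNorm` and
`‖complexify ∘ v‖²_{H¹} ≤ ∫‖v‖² + ‖∇v‖₂²`). [cite: RobinsonRodrigoSadowski2016, Thm 1.19] -/
theorem fluxLedger_lintegral_enorm_cube_le_energy (hd2 : 2 ≤ Fintype.card d)
    (hd4 : Fintype.card d ≤ 4) :
    ∃ K : ℝ≥0, ∀ v : UnitAddTorus d → EuclideanSpace ℝ d, MemLp v 2 volume →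
      ∫⁻ x, ‖v x‖ₑ ^ 3 ≤ (∫⁻ x, ‖v x‖ₑ ^ 2) ^ (1 / 2 : ℝ) *
        (((K : ℝ≥0∞) ^ (1 / 2 : ℝ)) * ((∫⁻ x, ‖v x‖ₑ ^ 2) + Torus.eGradNormSq v)) := by
  obtain ⟨K, hK⟩ := Torus.lintegral_enorm_pow_four_le_eSobolevNorm (d := d) hd2 hd4
  refine ⟨K, fun v hv => ?_⟩
  set H := Torus.eSobolevNorm 1 (Literature.Analysis.FunctionSpaces.EuclideanSpace.complexify ∘ v)
    with hH
  have h4 : ∫⁻ x, ‖v x‖ₑ ^ 4 ≤ K * H ^ 4 := hK v hv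
  have hH2 : H ^ 2 ≤ (∫⁻ x, ‖v x‖ₑ ^ 2) + Torus.eGradNormSq v :=
    Torus.eSobolevNorm_one_complexify_sq_le hv
  have hpow : (H ^ 4) ^ (1 / 2 : ℝ) = H ^ 2 := by
    rw [← ENNReal.rpow_natCast _ 4, ← ENNReal.rpow_natCast _ 2, ← ENNReal.rpow_mul]
    norm_num
  calc ∫⁻ x, ‖v x‖ₑ ^ 3
      ≤ (∫⁻ x, ‖v x‖ₑ ^ 2) ^ (1 / 2 : ℝ) * (∫⁻ x, ‖v x‖ₑ ^ 4) ^ (1 / 2 : ℝ) :=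
        fluxLedger_lintegral_enorm_cube_le hv.1
    _ ≤ (∫⁻ x, ‖v x‖ₑ ^ 2) ^ (1 / 2 : ℝ) * ((K : ℝ≥0∞) * H ^ 4) ^ (1 / 2 : ℝ) := by
        gcongr
    _ = (∫⁻ x, ‖v x‖ₑ ^ 2) ^ (1 / 2 : ℝ) * (((K : ℝ≥0∞) ^ (1 / 2 : ℝ)) * H ^ 2) := by
        rw [ENNReal.mul_rpow_of_nonneg _ _ (by norm_num : (0 : ℝ) ≤ 1 / 2), hpow]
    _ ≤ (∫⁻ x, ‖v x‖ₑ ^ 2) ^ (1 / 2 : ℝ) *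
          (((K : ℝ≥0∞) ^ (1 / 2 : ℝ)) * ((∫⁻ x, ‖v x‖ₑ ^ 2) + Torus.eGradNormSq v)) := by
        gcongr

variable {T ν : ℝ} {f : ℝ → UnitAddTorus d → EuclideanSpace ℝ d}
  {F u₀ : UnitAddTorus d → EuclideanSpace ℝ d} {u : ℝ → UnitAddTorus d → EuclideanSpace ℝ d}

/-- **A.e. slice bound along a Leray–Hopf solution**: on `T^d`, `2 ≤ d ≤ 4`, a Leray–Hopf weak
solution on `[0,T)` satisfies `∫‖u(t)‖³ ≤ M (∫‖u(t)‖² + ‖∇u(t)‖₂²)` for a.e. `t ∈ (0,T)` with a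
finite constant `M` (`= √C √K`, `C` the `L^∞L²` bound of the class). [cite: RobinsonRodrigoSadowski2016, Def. 4.9] -/
theorem fluxLedger_lerayHopf_ae_lintegral_enorm_cube_le (hd2 : 2 ≤ Fintype.card d)
    (hd4 : Fintype.card d ≤ 4) (hu : Torus.IsLerayHopfOn T ν f u₀ u) :
    ∃ M : ℝ≥0∞, M ≠ ⊤ ∧ ∀ᵐ t ∂(volume.restrict (Ioo 0 T)),
      ∫⁻ x, ‖u t x‖ₑ ^ 3 ≤ M * ((∫⁻ x, ‖u t x‖ₑ ^ 2) + Torus.eGradNormSq (u t)) := by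
  obtain ⟨K, hK⟩ := fluxLedger_lintegral_enorm_cube_le_energy (d := d) hd2 hd4
  obtain ⟨C, hC⟩ := hu.energy_bound
  refine ⟨((C : ℝ≥0∞) ^ (1 / 2 : ℝ)) * ((K : ℝ≥0∞) ^ (1 / 2 : ℝ)),
    ENNReal.mul_ne_top (ENNReal.rpow_ne_top_of_nonneg (by norm_num) ENNReal.coe_ne_top)
      (ENNReal.rpow_ne_top_of_nonneg (by norm_num) ENNReal.coe_ne_top), ?_⟩
  filter_upwards [hC, ae_restrict_mem measurableSet_Ioo] with t hCt ht
  have hv : MemLp (u t) 2 volume := hu.memLp t (Ioo_subset_Icc_self ht)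
  calc ∫⁻ x, ‖u t x‖ₑ ^ 3
      ≤ (∫⁻ x, ‖u t x‖ₑ ^ 2) ^ (1 / 2 : ℝ) *
          (((K : ℝ≥0∞) ^ (1 / 2 : ℝ)) * ((∫⁻ x, ‖u t x‖ₑ ^ 2) + Torus.eGradNormSq (u t))) :=
        hK (u t) hv
    _ ≤ ((C : ℝ≥0∞) ^ (1 / 2 : ℝ)) *
          (((K : ℝ≥0∞) ^ (1 / 2 : ℝ)) * ((∫⁻ x, ‖u t x‖ₑ ^ 2) + Torus.eGradNormSq (u t))) := by
        gcongr
    _ = ((C : ℝ≥0∞) ^ (1 / 2 : ℝ)) * ((K : ℝ≥0∞) ^ (1 / 2 : ℝ)) *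
          ((∫⁻ x, ‖u t x‖ₑ ^ 2) + Torus.eGradNormSq (u t)) := by rw [mul_assoc]

/-- The time integral of `∫‖u(t)‖² + ‖∇u(t)‖₂²` over `(0,T)` is finite along a Leray–Hopf solution
(`L^∞L²` and the spectral `L²H¹` clause). [folklore] -/
theorem fluxLedger_lerayHopf_lintegral_energy_add_enstrophy_lt_top
    (hu : Torus.IsLerayHopfOn T ν f u₀ u) :
    ∫⁻ t in Ioo 0 T, ((∫⁻ x, ‖u t x‖ₑ ^ 2) + Torus.eGradNormSq (u t)) < ⊤ := by
  obtain ⟨C, hC⟩ := hu.energy_bound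
  have h1 : ∫⁻ t in Ioo 0 T, (∫⁻ x, ‖u t x‖ₑ ^ 2) ≤ ∫⁻ t in Ioo 0 T, (C : ℝ≥0∞) :=
    lintegral_mono_ae hC
  have h1' : ∫⁻ t in Ioo 0 T, (C : ℝ≥0∞) < ⊤ := by
    rw [lintegral_const, Measure.restrict_apply MeasurableSet.univ, univ_inter, Real.volume_Ioo]
    exact ENNReal.mul_lt_top ENNReal.coe_lt_top ENNReal.ofReal_lt_top
  have h2 : ∫⁻ t in Ioo 0 T, Torus.eGradNormSq (u t) < ⊤ := hu.lintegral_eGradNormSq_lt_top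
  have hsplit : ∫⁻ t in Ioo 0 T, ((∫⁻ x, ‖u t x‖ₑ ^ 2) + Torus.eGradNormSq (u t)) =
      (∫⁻ t in Ioo 0 T, (∫⁻ x, ‖u t x‖ₑ ^ 2)) + ∫⁻ t in Ioo 0 T, Torus.eGradNormSq (u t) :=
    lintegral_add_right' _ hu.aemeasurable_eGradNormSq
  rw [hsplit]
  exact ENNReal.add_lt_top.2 ⟨lt_of_le_of_lt h1 h1', h2⟩

/-- **Leray–Hopf solutions on `T^d` (`2 ≤ d ≤ 4`) are in `L³((0,T) × T^d)`**:
`∫₀ᵀ ∫ ‖u‖³ < ∞` — the hypothesis `hu3` of the tree's Duchon–Robert facts. [cite: DuchonRobert2000, Prop. 1] -/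
theorem fluxLedger_lerayHopf_lintegral_enorm_cube_lt_top (hd2 : 2 ≤ Fintype.card d)
    (hd4 : Fintype.card d ≤ 4) (hu : Torus.IsLerayHopfOn T ν f u₀ u) :
    ∫⁻ t in Ioo 0 T, ∫⁻ x, ‖u t x‖ₑ ^ 3 < ⊤ := by
  obtain ⟨M, hM, hae⟩ := fluxLedger_lerayHopf_ae_lintegral_enorm_cube_le hd2 hd4 hu
  calc ∫⁻ t in Ioo 0 T, ∫⁻ x, ‖u t x‖ₑ ^ 3
      ≤ ∫⁻ t in Ioo 0 T, M * ((∫⁻ x, ‖u t x‖ₑ ^ 2) + Torus.eGradNormSq (u t)) :=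
        lintegral_mono_ae hae
    _ = M * ∫⁻ t in Ioo 0 T, ((∫⁻ x, ‖u t x‖ₑ ^ 2) + Torus.eGradNormSq (u t)) :=
        lintegral_const_mul' _ _ hM
    _ < ⊤ := ENNReal.mul_lt_top hM.lt_top
        (fluxLedger_lerayHopf_lintegral_energy_add_enstrophy_lt_top hu)

/-- **A.e. time slice of a Leray–Hopf solution is in `L³(T^d)`** (`2 ≤ d ≤ 4`). [folklore] -/
theorem fluxLedger_lerayHopf_ae_memLp_three (hd2 : 2 ≤ Fintype.card d)
    (hd4 : Fintype.card d ≤ 4) (hu : Torus.IsLerayHopfOn T ν f u₀ u) :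
    ∀ᵐ t ∂(volume.restrict (Ioo 0 T)), MemLp (u t) 3 volume := by
  obtain ⟨M, hM, hae⟩ := fluxLedger_lerayHopf_ae_lintegral_enorm_cube_le hd2 hd4 hu
  obtain ⟨C, hC⟩ := hu.energy_bound
  filter_upwards [hae, hC, hu.memL2Sobolev.1, ae_restrict_mem measurableSet_Ioo] with t h1 hCt h2 ht
  have hv : MemLp (u t) 2 volume := hu.memLp t (Ioo_subset_Icc_self ht)
  refine ⟨hv.1, ?_⟩
  rw [eLpNorm_lt_top_iff_lintegral_rpow_enorm_lt_top (by norm_num) (by norm_num)]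
  simp only [ENNReal.toReal_ofNat, ENNReal.rpow_ofNat]
  refine lt_of_le_of_lt h1 (ENNReal.mul_lt_top hM.lt_top (ENNReal.add_lt_top.2 ⟨?_, ?_⟩))
  · exact lt_of_le_of_lt hCt ENNReal.coe_lt_top
  · exact lt_of_le_of_lt (Torus.eGradNormSq_le (u t))
      (ENNReal.mul_lt_top ENNReal.ofReal_lt_top (ENNReal.pow_lt_top h2.2))

/-- **Global Leray–Hopf solutions at a steady mean-zero `L²` force**: the slice bound
`∫‖u(t)‖³ ≤ M (∫‖u(t)‖² + ‖∇u(t)‖₂²)` holds with ONE finite `M` for a.e. `t` in every `(0,T)`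
(the `L²` bound is uniform in time: `Torus.IsGlobalLerayHopf.exists_forall_integral_norm_sq_le_of_hasZeroMean`),
and `u ∈ L³((0,T) × T^d)` for every `T > 0`. [cite: FoiasManleyRosaTemam2001, Ch. IV §3.1 (3.2)] -/
theorem fluxLedger_globalLerayHopf_ae_lintegral_enorm_cube_le (hd2 : 2 ≤ Fintype.card d)
    (hd4 : Fintype.card d ≤ 4) (hν : 0 < ν) (hF : MemLp F 2 volume) (hF0 : Torus.HasZeroMean F)
    (hu : Torus.IsGlobalLerayHopf ν (fun _ => F) u₀ u) :
    ∃ M : ℝ≥0∞, M ≠ ⊤ ∧ ∀ T : ℝ, 0 < T →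
      (∀ᵐ t ∂(volume.restrict (Ioo 0 T)),
        ∫⁻ x, ‖u t x‖ₑ ^ 3 ≤ M * ((∫⁻ x, ‖u t x‖ₑ ^ 2) + Torus.eGradNormSq (u t))) ∧
      ∫⁻ t in Ioo 0 T, ∫⁻ x, ‖u t x‖ₑ ^ 3 < ⊤ := by
  obtain ⟨K, hK⟩ := fluxLedger_lintegral_enorm_cube_le_energy (d := d) hd2 hd4
  obtain ⟨R, hR⟩ := hu.exists_forall_integral_norm_sq_le_of_hasZeroMean hν hF hF0
  set M : ℝ≥0∞ := (ENNReal.ofReal R) ^ (1 / 2 : ℝ) * ((K : ℝ≥0∞) ^ (1 / 2 : ℝ)) with hMdef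
  have hM : M ≠ ⊤ :=
    ENNReal.mul_ne_top (ENNReal.rpow_ne_top_of_nonneg (by norm_num) ENNReal.ofReal_ne_top)
      (ENNReal.rpow_ne_top_of_nonneg (by norm_num) ENNReal.coe_ne_top)
  have hslice : ∀ t, 0 ≤ t → MemLp (u t) 2 volume →
      ∫⁻ x, ‖u t x‖ₑ ^ 3 ≤ M * ((∫⁻ x, ‖u t x‖ₑ ^ 2) + Torus.eGradNormSq (u t)) := by
    intro t ht hv
    have hsq : Integrable (fun x => ‖u t x‖ ^ 2) volume :=
      (memLp_two_iff_integrable_sq_norm hv.1).1 hv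
    have hE : ∫⁻ x, ‖u t x‖ₑ ^ 2 ≤ ENNReal.ofReal R := by
      have hconv : ∫⁻ x, ‖u t x‖ₑ ^ 2 = ENNReal.ofReal (∫ x, ‖u t x‖ ^ 2) := by
        rw [ofReal_integral_eq_lintegral_ofReal hsq (Eventually.of_forall fun x => by positivity)]
        refine lintegral_congr fun x => ?_
        rw [ENNReal.ofReal_pow (norm_nonneg _), ofReal_norm]
      rw [hconv]
      exact ENNReal.ofReal_le_ofReal (hR t ht)
    calc ∫⁻ x, ‖u t x‖ₑ ^ 3
        ≤ (∫⁻ x, ‖u t x‖ₑ ^ 2) ^ (1 / 2 : ℝ) *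
            (((K : ℝ≥0∞) ^ (1 / 2 : ℝ)) * ((∫⁻ x, ‖u t x‖ₑ ^ 2) + Torus.eGradNormSq (u t))) :=
          hK (u t) hv
      _ ≤ (ENNReal.ofReal R) ^ (1 / 2 : ℝ) *
            (((K : ℝ≥0∞) ^ (1 / 2 : ℝ)) * ((∫⁻ x, ‖u t x‖ₑ ^ 2) + Torus.eGradNormSq (u t))) := by
          gcongr
      _ = M * ((∫⁻ x, ‖u t x‖ₑ ^ 2) + Torus.eGradNormSq (u t)) := by rw [hMdef, mul_assoc]
  refine ⟨M, hM, fun T hT => ?_⟩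
  have hLH := hu T hT
  have hae : ∀ᵐ t ∂(volume.restrict (Ioo 0 T)),
      ∫⁻ x, ‖u t x‖ₑ ^ 3 ≤ M * ((∫⁻ x, ‖u t x‖ₑ ^ 2) + Torus.eGradNormSq (u t)) := by
    filter_upwards [ae_restrict_mem measurableSet_Ioo] with t ht
    exact hslice t ht.1.le (hLH.memLp t (Ioo_subset_Icc_self ht))
  refine ⟨hae, ?_⟩
  calc ∫⁻ t in Ioo 0 T, ∫⁻ x, ‖u t x‖ₑ ^ 3
      ≤ ∫⁻ t in Ioo 0 T, M * ((∫⁻ x, ‖u t x‖ₑ ^ 2) + Torus.eGradNormSq (u t)) :=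
        lintegral_mono_ae hae
    _ = M * ∫⁻ t in Ioo 0 T, ((∫⁻ x, ‖u t x‖ₑ ^ 2) + Torus.eGradNormSq (u t)) :=
        lintegral_const_mul' _ _ hM
    _ < ⊤ := ENNReal.mul_lt_top hM.lt_top
        (fluxLedger_lerayHopf_lintegral_energy_add_enstrophy_lt_top hLH)

end Summit.AnomalousDissipation.AnomalousDissipation.Theorems

end
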